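import Summits.CriticalPhenomena.PercolationContinuityZ3.Theorems.PercNearOneGluingNoHeavyLowerTailMixCSHUnfold
import Summits.CriticalPhenomena.PercolationContinuityZ3.Theorems.PercNearOneGluingNoHeavyLowerTailCSHUnfoldMain
import HarnessLib

/-!
# `NoHeavyLowerTail` (stmt-CriticalPhenomena-4575) — MIXED conditioned slack hierarchy (hub observer): LEMMA U FOR GENERAL `k`, assembled
# (the world-wise mixed within-margin = mixed H-part + lower-level MIXED margins − remainders `R_j`)

Support file (`--supports stmt-CriticalPhenomena-4575`), prover `prim-hp-7` (gen 33); part (d), assembly, of brick B2 (`MixCSHUnfold`) of prim-ineq-gen-7's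
Lean blueprint for THEOREM M1 (memo `prim-ineq-gen-7/PROOF-Q9-MIXED-CSH.md` §3.2–3.5 / §10, write-up `Q9-WRITEUP.md` Lemma 6.3 and §6.5).  No definitions, no
named facts, no sorries.

`MixCSH.mix_within_unfold` — for weights `< 1` (the hierarchy runs on `H = G − E(o)`), owner `x`, avoided set `Y`, distinct decoys `D` (off `x`, `Y`, `o`, `v`), hub set `Σ`, hub label `o ≠ v`,
any real `p` and any functional `g` of the open edge cluster of `x`, the `{x↮Y}`-integral of the level-form margin (MIXED list) of the world quantities of the
mixed Lemma T (`MixCSH.mixCshMargin_nonneg_of_within`, hypothesis `hW`: at a vertex `u` the world covariance `Cov_{w^ω}(g(C_x), 1{x↔u})`, at the hub label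
`1{Σ ↮ Y}(ω)·Cov_{w^ω}(g(C_x), 1{Σ ↔ x})`) EQUALS

  `∫_{x↮Y} [1{Σ↮Y}(ω)·Cov_{w^ω}(g(C_x), 1{Σ ↔ S}) − p·Cov_{w^ω}(g(C_x), 1{v ↔ S})] dμ_w  +  (mixSubT(o) − p·subT(v))  −  remSum`,   `S = {x} ∪ D`,

the first term literally in the shape of the conclusion of prim-ineq-gen-7's Lemma H-mix `MixCSH.hpart_nonneg_hub` (`…MixCSHHtwBridge.lean`, brick B4), the
second the accumulated lower-level terms (`MixCSH.mixSubT` at the hub, prim-ineq-prove-1's `CSH.subT` at `v`), the third the accumulated remainders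
`MixCSH.remSum = Σ_j μ(E_j)·R_j` (`MixCSH.hubRem`).  `MixCSH.mixSubT_comb_nonneg` — `mixSubT(o) − p·subT(v) = Σ_j μ(E_j)⁻¹ · mixCshMargin w Σ d_j Y_j D_{>j} o v Φ̃_j ≥ 0`
as soon as every lower-level MIXED margin at the monotone nonnegative functionals `Φ̃_j` is nonnegative, for `p = mixObsConst w Σ v ({x} ∪ Y ∪ D)`.
`MixCSH.mix_within_nonneg_of_hpart` — hence the world-wise mixed margin is `≥ 0` given the lower levels, `Hpart-mix ≥ 0` and the remainders `≤ 0` (Lemma R⁻,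
brick B3, taken as the hypothesis `hR`).  The companion file `…MixCSHUnfoldHpart.lean` discharges `Hpart-mix ≥ 0` by prim-ineq-gen-7's
`MixCSH.hpart_nonneg_hub` (kept apart: that file's import context synthesises different `Decidable` instances inside the world weights).
[cite: VandenbergHaggstromKahn2005, §2.1 Lemma 2.4 (p. 10); §1 display (10) (pp. 7–8) — corollaries] [cite: KozmaNitzan2024, Question 9 (§5.5 p. 36), Conj. 4 (p. 32)]
-/

noncomputable section

namespace Summit.CriticalPhenomena.PercolationContinuityZ3.Theorems

open MeasureTheory Set Literature.Probability.LatticeModels Literature.Probability.Percolation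
open scoped Classical
open BHK2006 DecisionTree HullPort CSH

namespace MixCSH

variable {V : Type*}

/-! ### Small dictionary -/

variable [Fintype V]

/-- The mixed observation test of the owner's singleton in the world of `ω`: `mixJn_{{x}}(u)` is `1{x ↔ u}` at a vertex and
`1{Σ ↮ Y}(ω)·1{Σ ↔ x}` at the hub label (stated in the `Fintype` context of its use, so that the decidability instances of the
indicator agree). [folklore] -/
theorem mixJn_singleton_eq (Sig Y : Set V) (o x : V) (ω β : Set (Sym2 V)) (u : V) :
    mixJn (openGraph β).Reachable (hubPred Sig Y ω β) o {x} u =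
      if u = o then (if (∀ z ∈ Sig, ∀ y ∈ Y, ¬ (openGraph ω).Reachable y z) then (1 : ℝ) else 0) *
          ind {η : Set (Sym2 V) | ∃ z ∈ Sig, (openGraph η).Reachable x z} β
        else ind (openConn x u : Set (BondConfig V)) β := by
  rw [mixJn_singleton]
  by_cases hu : u = o
  · rw [if_pos hu, if_pos hu]
    unfold hubPred
    by_cases hq : ∀ z ∈ Sig, ∀ y ∈ Y, ¬ (openGraph ω).Reachable y z
    · rw [if_pos hq, one_mul]
      by_cases hx : ∃ z ∈ Sig, (openGraph β).Reachable x z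
      · rw [if_pos ⟨hq, hx⟩, ind_of_mem (show β ∈ {η : Set (Sym2 V) | ∃ z ∈ Sig, (openGraph η).Reachable x z} from hx)]
      · rw [if_neg (fun h => hx h.2), ind_of_not_mem (show β ∉ {η : Set (Sym2 V) | ∃ z ∈ Sig, (openGraph η).Reachable x z} from hx)]
    · rw [if_neg hq, zero_mul, if_neg (fun h => hq h.1)]
  · rw [if_neg hu, if_neg hu, chi_reachable_eq_ind]

/-- The hub entry of the mixed row function of a finite source set `S` in the world of `ω`:
`1{∃ s ∈ S, hub ↔ s} = 1{Σ ↮ Y}(ω) · 1{∃ σ ∈ Σ, ∃ t ∈ S, t ↔ σ}` (stated in the `Fintype` context of its use). [folklore] -/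
theorem hubJn_hubPred_eq (Sig Y : Set V) (S : Finset V) (ω β : Set (Sym2 V)) :
    hubJn (hubPred Sig Y ω β) (↑S : Set V) =
      (if (∀ z ∈ Sig, ∀ y ∈ Y, ¬ (openGraph ω).Reachable y z) then (1 : ℝ) else 0) *
        ind {η : Set (Sym2 V) | ∃ z ∈ Sig, ∃ t ∈ S, (openGraph η).Reachable t z} β := by
  unfold hubJn hubPred
  by_cases hq : ∀ z ∈ Sig, ∀ y ∈ Y, ¬ (openGraph ω).Reachable y z
  · rw [if_pos hq, one_mul]
    by_cases hx : ∃ z ∈ Sig, ∃ t ∈ S, (openGraph β).Reachable t z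
    · rw [ind_of_mem (show β ∈ {η : Set (Sym2 V) | ∃ z ∈ Sig, ∃ t ∈ S, (openGraph η).Reachable t z} from hx), if_pos]
      obtain ⟨z, hz, t, ht, htz⟩ := hx
      exact ⟨t, Finset.mem_coe.2 ht, hq, z, hz, htz⟩
    · rw [ind_of_not_mem (show β ∉ {η : Set (Sym2 V) | ∃ z ∈ Sig, ∃ t ∈ S, (openGraph η).Reachable t z} from hx), if_neg]
      rintro ⟨t, ht, -, z, hz, htz⟩
      exact hx ⟨z, hz, t, Finset.mem_coe.1 ht, htz⟩
  · rw [if_neg hq, zero_mul, if_neg]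
    rintro ⟨t, -, hq', -⟩
    exact hq hq'


/-- The world covariance is homogeneous in the test function. [folklore] -/
theorem wcovOff_const_mul (w : Sym2 V → ℝ) (Y : Set V) (φ ψ : Set (Sym2 V) → ℝ) (a : ℝ) (ω : Set (Sym2 V)) :
    wcovOff w Y φ (fun ζ => a * ψ ζ) ω = a * wcovOff w Y φ ψ ω := by
  rw [wcovOff_eq_sum w, wcovOff_eq_sum w, Finset.mul_sum]
  exact Finset.sum_congr rfl fun η _ => by ring

/-! ### The main identity -/

/-- **MIXED LEMMA U FOR GENERAL `k`** (memo §3.2, assembled): the `{x↮Y}`-integral of the margin (mixed list) of the world quantities of the mixed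
Lemma T equals the mixed H-part plus `mixSubT(o) − p·subT(v)` minus the accumulated remainders `remSum`.
(transcription of the cell memo prim-ineq-gen-7 PROOF-Q9-MIXED-CSH.md §3.2, Lemma U mixed)
[cite: VandenbergHaggstromKahn2005, §2.1 Lemma 2.4 (p. 10); §1 display (10) (pp. 7–8) — corollaries] -/
theorem mix_within_unfold (w : Sym2 V → unitInterval) (hw : ∀ e, w e < 1) (Sig : Set V) (x : V) (Y : Set V) (D : List V)
    (o v : V) (hov : o ≠ v) (hnd : D.Nodup) (hD : ∀ d ∈ D, d ≠ x ∧ d ∉ Y ∧ d ≠ o ∧ d ≠ v) (g : Set (Sym2 V) → ℝ) (p : ℝ) :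
    ∫ ω in {ω : BondConfig V | ∀ y ∈ Y, ¬ (openGraph ω).Reachable x y},
        cshMarg (mixDecoyList w Sig o (insert x Y) D) p o v
          (fun u => if u = o then
              (if (∀ z ∈ Sig, ∀ y ∈ Y, ¬ (openGraph ω).Reachable y z) then (1 : ℝ) else 0) *
                ((∫ η in {η : BondConfig V | ∃ z ∈ Sig, (openGraph η).Reachable x z}, g (openEdgeCluster η x)
                    ∂(prodBernoulli fun e => if (∃ z ∈ e, ∃ y ∈ Y, (openGraph ω).Reachable y z)
                      then (0 : unitInterval) else w e)) -
                  (∫ η, g (openEdgeCluster η x)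
                    ∂(prodBernoulli fun e => if (∃ z ∈ e, ∃ y ∈ Y, (openGraph ω).Reachable y z)
                      then (0 : unitInterval) else w e)) *
                  (prodBernoulli fun e => if (∃ z ∈ e, ∃ y ∈ Y, (openGraph ω).Reachable y z)
                      then (0 : unitInterval) else w e).real
                    {η : BondConfig V | ∃ z ∈ Sig, (openGraph η).Reachable x z})
            else
              (∫ η in (openConn x u : Set (BondConfig V)), g (openEdgeCluster η x)
                  ∂(prodBernoulli fun e => if (∃ z ∈ e, ∃ y ∈ Y, (openGraph ω).Reachable y z)
                    then (0 : unitInterval) else w e)) -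
                (∫ η, g (openEdgeCluster η x)
                  ∂(prodBernoulli fun e => if (∃ z ∈ e, ∃ y ∈ Y, (openGraph ω).Reachable y z)
                    then (0 : unitInterval) else w e)) *
                (prodBernoulli fun e => if (∃ z ∈ e, ∃ y ∈ Y, (openGraph ω).Reachable y z)
                    then (0 : unitInterval) else w e).real (openConn x u : Set (BondConfig V)))
        ∂(prodBernoulli w) =
      (∫ ω in {ω : BondConfig V | ∀ y ∈ Y, ¬ (openGraph ω).Reachable x y},
        ((if (∀ z ∈ Sig, ∀ y ∈ Y, ¬ (openGraph ω).Reachable y z) then (1 : ℝ) else 0) *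
            ((∫ η in {η : BondConfig V | ∃ z ∈ Sig, ∃ t ∈ insert x D.toFinset, (openGraph η).Reachable t z}, g (openEdgeCluster η x)
                ∂(prodBernoulli fun e => if (∃ z ∈ e, ∃ y ∈ Y, (openGraph ω).Reachable y z) then (0 : unitInterval) else w e)) -
              (prodBernoulli fun e => if (∃ z ∈ e, ∃ y ∈ Y, (openGraph ω).Reachable y z) then (0 : unitInterval) else w e).real
                  {η : BondConfig V | ∃ z ∈ Sig, ∃ t ∈ insert x D.toFinset, (openGraph η).Reachable t z} *
                (∫ η, g (openEdgeCluster η x)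
                  ∂(prodBernoulli fun e => if (∃ z ∈ e, ∃ y ∈ Y, (openGraph ω).Reachable y z) then (0 : unitInterval) else w e))) -
          p * ((∫ η in (⋃ t ∈ insert x D.toFinset, openConn v t), g (openEdgeCluster η x)
                ∂(prodBernoulli fun e => if (∃ z ∈ e, ∃ y ∈ Y, (openGraph ω).Reachable y z) then (0 : unitInterval) else w e)) -
              (prodBernoulli fun e => if (∃ z ∈ e, ∃ y ∈ Y, (openGraph ω).Reachable y z) then (0 : unitInterval) else w e).real
                  (⋃ t ∈ insert x D.toFinset, openConn v t) *
                (∫ η, g (openEdgeCluster η x)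
                  ∂(prodBernoulli fun e => if (∃ z ∈ e, ∃ y ∈ Y, (openGraph ω).Reachable y z) then (0 : unitInterval) else w e))))
        ∂(prodBernoulli w)) +
      (mixSubT w Sig o x Y g {x} D - p * subT w x Y g v {x} D) - remSum w Sig x Y g {x} D := by
  classical
  set ŵ : Sym2 V → ℝ := fun e => (w e : ℝ) with hŵ
  have hm : ∑ ω, weight ŵ ω = 1 := by
    have h1 := integral_prodBernoulli_eq_sum w fun _ => (1 : ℝ)
    simp only [integral_const, probReal_univ, smul_eq_mul, mul_one] at h1
    exact h1.symm
  set L := mixDecoyList w Sig o (insert x Y) D with hLdef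
  set G : Set (Sym2 V) → ℝ := fun β => g (openEdgeCluster β x) with hG
  have hDev : {ω : BondConfig V | ∀ y ∈ Y, ¬ (openGraph ω).Reachable x y} = avoidEv x Y := rfl
  have hL' : L = mixDecoyList w Sig o ({x} ∪ Y) D := by rw [hLdef, ← Set.insert_eq]
  have hdecs : {d : V | d ∈ L.map Prod.fst} = {d | d ∈ D} := by rw [hLdef, map_fst_mixDecoyList]
  have hDo' : ∀ d ∈ D, d ≠ o := fun d hd => (hD d hd).2.2.1
  have hLo : ∀ dc ∈ L, dc.1 ≠ o := fst_ne_of_mem_mixDecoyList w Sig o _ D hDo'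
  set Sset : Set V := {x} ∪ {d | d ∈ D} with hSset
  have hSfin : (↑(insert x D.toFinset) : Set V) = Sset := by
    ext u; simp [hSset]
  -- the frozen factor and the world test functions
  set q : Set (Sym2 V) → ℝ := fun ω => if (∀ z ∈ Sig, ∀ y ∈ Y, ¬ (openGraph ω).Reachable y z) then (1 : ℝ) else 0 with hq
  set Hx : Set (Set (Sym2 V)) := {η | ∃ z ∈ Sig, (openGraph η).Reachable x z} with hHx
  set HS : Set (Set (Sym2 V)) := {η | ∃ z ∈ Sig, ∃ t ∈ insert x D.toFinset, (openGraph η).Reachable t z} with hHS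
  set Jo : Set (Sym2 V) → Set (Sym2 V) → ℝ := fun ω β => mixJn (openGraph β).Reachable (hubPred Sig Y ω β) o Sset o with hJo
  set Jv : Set (Sym2 V) → ℝ := fun β => jn (openGraph β).Reachable Sset v with hJv
  set To : Set (Sym2 V) → Set (Sym2 V) → ℝ := fun ω β => mixUnfoldT (openGraph β).Reachable (hubPred Sig Y ω β) o {x} L o with hTo
  set Tv : Set (Sym2 V) → ℝ := fun β => unfoldT (openGraph β).Reachable {x} (decoyList w ({x} ∪ Y) D) v with hTv
  -- Step A: the integrand is a margin of world covariances (sum vocabulary)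
  rw [hDev, setIntegral_eq_sum_ind, setIntegral_eq_sum_ind]
  simp only [world_cov_eq_wcovOff]
  -- Step B: pointwise unfolding of the margin of the world covariances
  have stepB : ∀ ω, cshMarg L p o v (fun u => if u = o then q ω * wcovOff ŵ Y G (ind Hx) ω
        else wcovOff ŵ Y G (ind (openConn x u : Set (BondConfig V))) ω) =
      wcovOff ŵ Y G (Jo ω) ω - p * wcovOff ŵ Y G Jv ω - wcovOff ŵ Y G (To ω) ω + p * wcovOff ŵ Y G Tv ω := by
    intro ω
    have hfun : (fun u => if u = o then q ω * wcovOff ŵ Y G (ind Hx) ω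
        else wcovOff ŵ Y G (ind (openConn x u : Set (BondConfig V))) ω) =
        fun u => wcovOff ŵ Y G (fun β => mixJn (openGraph β).Reachable (hubPred Sig Y ω β) o {x} u) ω := by
      funext u
      by_cases hu : u = o
      · rw [if_pos hu, ← wcovOff_const_mul]
        congr 1
        funext β
        rw [mixJn_singleton_eq, if_pos hu]
      · rw [if_neg hu]
        congr 1
        funext β
        rw [mixJn_singleton_eq, if_neg hu]
    rw [hfun, cshMarg_eq_sum_single, wcovOff_finset_sum]
    have inner : (fun ζ => ∑ u, cshMarg L p o v (Pi.single u (1 : ℝ)) *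
        mixJn (openGraph ζ).Reachable (hubPred Sig Y ω ζ) o {x} u) =
        fun ζ => (Jo ω ζ - p * Jv ζ) - (To ω ζ - p * Tv ζ) + (unfoldK L o - p * unfoldK L v) := by
      funext ζ
      rw [← cshMarg_eq_sum_single L p o v (mixJn (openGraph ζ).Reachable (hubPred Sig Y ω ζ) o {x})]
      simp only [cshMarg, slForm_mixJn (openGraph ζ).Reachable (hubPred Sig Y ω ζ) o (fun a b h => h.symm)
        (fun a b c h h' => h.trans h') (hubPred_closed Sig Y ω ζ) L hLo {x}, hdecs, hJo, hJv, hTo, hTv, hSset]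
      rw [mixJn_of_ne _ _ _ _ hov.symm, mixUnfoldT_of_ne _ _ _ L hLo {x} hov.symm, hL',
        unfoldT_mixDecoyList_of_ne w Sig o _ D {x} ({x} ∪ Y) v hDo' hov.symm]
      ring
    rw [inner, wcovOff_affine ŵ hm]
  -- Step C: sum over ω; the `unfoldT` parts are `−mixSubT + remSum` (hub row) and `−subT` (row of `v`)
  have hDo : ∀ d ∈ D, d ∉ ({x} : Set V) ∧ d ∉ Y ∧ d ≠ o := fun d hd =>
    ⟨fun h => (hD d hd).1 (Set.mem_singleton_iff.1 h), (hD d hd).2.1, (hD d hd).2.2.1⟩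
  have hDv : ∀ d ∈ D, d ∉ ({x} : Set V) ∧ d ∉ Y ∧ d ≠ v := fun d hd =>
    ⟨fun h => (hD d hd).1 (Set.mem_singleton_iff.1 h), (hD d hd).2.1, (hD d hd).2.2.2⟩
  have stepCo := sum_wcov_mixUnfoldT w hw Sig o x Y g D {x} (Set.mem_singleton x) hnd hDo
  have stepCv := sum_wcov_unfoldT_of_lt_one w hw x Y g v D {x} (Set.mem_singleton x) hnd hDv
  rw [← hL'] at stepCo
  have e : ∀ ω, weight ŵ ω * (ind (avoidEv x Y) ω *
      cshMarg L p o v (fun u => if u = o then q ω * wcovOff ŵ Y G (ind Hx) ω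
        else wcovOff ŵ Y G (ind (openConn x u : Set (BondConfig V))) ω)) =
      weight ŵ ω * (ind (avoidEv x Y) ω * (wcovOff ŵ Y G (Jo ω) ω - p * wcovOff ŵ Y G Jv ω)) -
        weight ŵ ω * (ind (avoidEv x Y) ω * wcovOff ŵ Y G (To ω) ω) +
        p * (weight ŵ ω * (ind (avoidEv x Y) ω * wcovOff ŵ Y G Tv ω)) := by
    intro ω; rw [stepB ω]; ring
  rw [Finset.sum_congr rfl (fun ω _ => e ω), Finset.sum_add_distrib, Finset.sum_sub_distrib, ← Finset.mul_sum]
  change (∑ ω, weight ŵ ω * (ind (avoidEv x Y) ω * (wcovOff ŵ Y G (Jo ω) ω - p * wcovOff ŵ Y G Jv ω))) -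
      (∑ ω, weight ŵ ω * (ind (avoidEv x Y) ω * wcovOff ŵ Y G
        (fun β => mixUnfoldT (openGraph β).Reachable (hubPred Sig Y ω β) o {x} L o) ω)) +
      p * (∑ ω, weight ŵ ω * (ind (avoidEv x Y) ω * wcovOff ŵ Y G
        (fun β => unfoldT (openGraph β).Reachable {x} (decoyList w ({x} ∪ Y) D) v) ω)) = _
  rw [stepCo, stepCv]
  -- Step D: the H-part back in measure form
  have hJo' : ∀ ω, Jo ω = fun β => q ω * ind HS β := by
    intro ω; funext β
    simp only [hJo, hq, hHS]
    rw [mixJn_hub, ← hSfin, hubJn_hubPred_eq]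
  have hJv' : Jv = ind (⋃ t ∈ insert x D.toFinset, (openConn v t : Set (BondConfig V))) := by
    funext β
    simp only [hJv]
    rw [jn_reachable_eq_ind, ← setOf_exists_reachable_eq_iUnion, hSfin]
  have eH : ∀ ω, weight ŵ ω * (ind (avoidEv x Y) ω * (wcovOff ŵ Y G (Jo ω) ω - p * wcovOff ŵ Y G Jv ω)) =
      weight ŵ ω * (ind (avoidEv x Y) ω *
        (q ω * wcovOff ŵ Y G (ind HS) ω - p * wcovOff ŵ Y G (ind (⋃ t ∈ insert x D.toFinset, (openConn v t : Set (BondConfig V)))) ω)) := by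
    intro ω; rw [hJo' ω, hJv', wcovOff_const_mul]
  rw [Finset.sum_congr rfl (fun ω _ => eH ω)]
  have eM : ∀ ω, weight ŵ ω * (ind (avoidEv x Y) ω *
      (q ω * ((∫ η in HS, g (openEdgeCluster η x)
            ∂(prodBernoulli fun e => if (∃ z ∈ e, ∃ y ∈ Y, (openGraph ω).Reachable y z) then (0 : unitInterval) else w e)) -
          (prodBernoulli fun e => if (∃ z ∈ e, ∃ y ∈ Y, (openGraph ω).Reachable y z) then (0 : unitInterval) else w e).real HS *
            (∫ η, g (openEdgeCluster η x)
              ∂(prodBernoulli fun e => if (∃ z ∈ e, ∃ y ∈ Y, (openGraph ω).Reachable y z) then (0 : unitInterval) else w e))) -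
        p * ((∫ η in (⋃ t ∈ insert x D.toFinset, openConn v t), g (openEdgeCluster η x)
            ∂(prodBernoulli fun e => if (∃ z ∈ e, ∃ y ∈ Y, (openGraph ω).Reachable y z) then (0 : unitInterval) else w e)) -
          (prodBernoulli fun e => if (∃ z ∈ e, ∃ y ∈ Y, (openGraph ω).Reachable y z) then (0 : unitInterval) else w e).real
              (⋃ t ∈ insert x D.toFinset, openConn v t) *
            (∫ η, g (openEdgeCluster η x)
              ∂(prodBernoulli fun e => if (∃ z ∈ e, ∃ y ∈ Y, (openGraph ω).Reachable y z) then (0 : unitInterval) else w e))))) =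
      weight ŵ ω * (ind (avoidEv x Y) ω *
        (q ω * wcovOff ŵ Y G (ind HS) ω - p * wcovOff ŵ Y G (ind (⋃ t ∈ insert x D.toFinset, (openConn v t : Set (BondConfig V)))) ω)) := by
    intro ω
    rw [← world_cov_eq_wcovOff w Y ω G, ← world_cov_eq_wcovOff w Y ω G]
    ring
  rw [Finset.sum_congr rfl (fun ω _ => eM ω)]
  ring

/-! ### The lower-level terms are nonnegative given the lower MIXED levels -/

/-- **`mixSubT(o) − p·subT(v) ≥ 0` from the lower MIXED levels** (memo §3.5): along the splittings `D₀ = pre ++ rest`, with the source set `S = {x} ∪ pre`,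
`mixSubT_S(rest)(o) − p·subT_S(rest)(v) = Σ_{d ∈ rest} μ(E_d)⁻¹ · mixCshMargin w Σ d ({x}∪Y∪pre_d) rest_{>d} o v Φ̃_d`, each term nonnegative when the lower-level
MIXED margins at the monotone nonnegative functionals `Φ̃_d` are (hypothesis `hIH`) and `p = mixObsConst w Σ v ({x} ∪ Y ∪ D₀)`.  (The `v`-row of the mixed
sub-system is the pure one: `MixCSH.slForm_mixDecoyList_of_ne`.)
(transcription of the cell memo prim-ineq-gen-7 PROOF-Q9-MIXED-CSH.md §3.5) [cite: KozmaNitzan2024, Question 9 (§5.5 p. 36)] -/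
theorem mixSubT_comb_nonneg (w : Sym2 V → unitInterval) (Sig : Set V) (x : V) (Y : Set V) (D₀ : List V) (o v : V) (hov : o ≠ v)
    (hD₀ : ∀ d ∈ D₀, d ≠ o) {g : Set (Sym2 V) → ℝ} (hg : Monotone g)
    (hIH : ∀ (pre : List V) (d : V) (ds' : List V), D₀ = pre ++ d :: ds' →
      ∀ h : Set (Sym2 V) → ℝ, Monotone h → (∀ C, 0 ≤ h C) →
        0 ≤ mixCshMargin w Sig d (insert x Y ∪ {e | e ∈ pre}) ds' o v h) :
    ∀ (rest pre : List V), D₀ = pre ++ rest →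
      0 ≤ mixSubT w Sig o x Y g ({x} ∪ {e | e ∈ pre}) rest -
        mixObsConst w Sig v (insert x Y ∪ {d | d ∈ D₀}) * subT w x Y g v ({x} ∪ {e | e ∈ pre}) rest := by
  intro rest
  induction rest with
  | nil => intro pre _; simp [mixSubT, subT]
  | cons d ds ih =>
    intro pre hsplit
    set A : Set V := {x} ∪ {e | e ∈ pre} ∪ Y with hA
    have hA' : A = insert x Y ∪ {e | e ∈ pre} := by
      ext u; simp only [hA, Set.mem_union, Set.mem_singleton_iff, Set.mem_setOf_eq, Set.mem_insert_iff]; tauto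
    have hset : insert d A ∪ {e | e ∈ ds} = insert x Y ∪ {e | e ∈ D₀} := by
      ext u
      simp only [hA, hsplit, Set.mem_union, Set.mem_insert_iff, Set.mem_singleton_iff, Set.mem_setOf_eq, List.mem_append,
        List.mem_cons]
      tauto
    have hds : ∀ e ∈ ds, e ≠ o := fun e he => hD₀ e (by rw [hsplit]; exact List.mem_append_right pre (List.mem_cons_of_mem d he))
    -- the `v`-row of the mixed sub-system is the pure one
    have hv_row : slForm (mixDecoyList w Sig o (insert d A) ds) (mixCovD w Sig o d A (phiT w x Y g d)) v =
        slForm (decoyList w (insert d A) ds) (covD w d A (phiT w x Y g d)) v :=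
      slForm_mixDecoyList_of_ne w Sig o ds (insert d A) _ _ v hds hov.symm (fun w' hw' => mixCovD_of_ne w Sig hw' d A _)
    -- the head term is `μ(E)⁻¹ · mixCshMargin w Σ d A ds o v Φ̃_d ≥ 0`
    have hmargin : slForm (mixDecoyList w Sig o (insert d A) ds) (mixCovD w Sig o d A (phiT w x Y g d)) o -
        mixObsConst w Sig v (insert x Y ∪ {e | e ∈ D₀}) * slForm (decoyList w (insert d A) ds) (covD w d A (phiT w x Y g d)) v =
        mixCshMargin w Sig d (insert x Y ∪ {e | e ∈ pre}) ds o v (phiT w x Y g d) := by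
      rw [← hv_row, ← hset, ← hA']; rfl
    have hhead : 0 ≤ mixCshMargin w Sig d (insert x Y ∪ {e | e ∈ pre}) ds o v (phiT w x Y g d) :=
      hIH pre d ds hsplit (phiT w x Y g d) (phiT_mono w x Y hg d) (fun K => phiFun_nonneg w x Y hg _)
    have hinv : 0 ≤ ((prodBernoulli w).real (avoidEv d A))⁻¹ := inv_nonneg.2 measureReal_nonneg
    -- the tail by induction with `pre ++ [d]`
    have htail := ih (pre ++ [d]) (by rw [hsplit]; simp)
    have hS' : ({x} ∪ {e | e ∈ pre ++ [d]} : Set V) = insert d ({x} ∪ {e | e ∈ pre}) := by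
      ext u
      simp only [Set.mem_union, Set.mem_singleton_iff, Set.mem_setOf_eq, List.mem_append, List.mem_singleton, Set.mem_insert_iff]
      tauto
    rw [hS'] at htail
    have hSY : ({x} ∪ {e | e ∈ pre} : Set V) ∪ Y = A := rfl
    simp only [mixSubT, subT, hSY]
    have key : ((prodBernoulli w).real (avoidEv d A))⁻¹ *
          slForm (mixDecoyList w Sig o (insert d A) ds) (mixCovD w Sig o d A (phiT w x Y g d)) o +
        mixSubT w Sig o x Y g (insert d ({x} ∪ {e | e ∈ pre})) ds -
        mixObsConst w Sig v (insert x Y ∪ {d | d ∈ D₀}) *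
          (((prodBernoulli w).real (avoidEv d A))⁻¹ *
              slForm (decoyList w (insert d A) ds) (covD w d A (phiT w x Y g d)) v +
            subT w x Y g v (insert d ({x} ∪ {e | e ∈ pre})) ds) =
        ((prodBernoulli w).real (avoidEv d A))⁻¹ * mixCshMargin w Sig d (insert x Y ∪ {e | e ∈ pre}) ds o v (phiT w x Y g d) +
          (mixSubT w Sig o x Y g (insert d ({x} ∪ {e | e ∈ pre})) ds -
            mixObsConst w Sig v (insert x Y ∪ {d | d ∈ D₀}) * subT w x Y g v (insert d ({x} ∪ {e | e ∈ pre})) ds) := by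
      rw [← hmargin]; ring
    rw [key]
    exact add_nonneg (mul_nonneg hinv hhead) htail

/-- **The accumulated remainders are `≤ 0` when every single remainder is** (the form in which Lemma R⁻, brick B3, enters). [folklore] -/
theorem remSum_nonpos (w : Sym2 V → unitInterval) (Sig : Set V) (x : V) (Y : Set V) (g : Set (Sym2 V) → ℝ)
    (hR : ∀ (S : Set V) (d : V), x ∈ S → d ∉ S → d ∉ Y → hubRem (fun e => (w e : ℝ)) x Y g Sig d (S ∪ Y) ≤ 0) :
    ∀ (D : List V) (S : Set V), x ∈ S → D.Nodup → (∀ d ∈ D, d ∉ S ∧ d ∉ Y) → remSum w Sig x Y g S D ≤ 0 := by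
  intro D
  induction D with
  | nil => intro S _ _ _; simp [remSum]
  | cons d ds ih =>
    intro S hxS hnd hdis
    have hd_notin : d ∉ ds := (List.nodup_cons.1 hnd).1
    simp only [remSum]
    refine add_nonpos (hR S d hxS (hdis d List.mem_cons_self).1 (hdis d List.mem_cons_self).2) ?_
    exact ih (insert d S) (Set.mem_insert_of_mem d hxS) (List.nodup_cons.1 hnd).2 (fun e he =>
      ⟨fun h' => (Set.mem_insert_iff.1 h').elim (fun h0 => hd_notin (h0 ▸ he)) (hdis e (List.mem_cons_of_mem d he)).1,
        (hdis e (List.mem_cons_of_mem d he)).2⟩)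

/-- **The world-wise MIXED margin is nonnegative given the lower MIXED levels, the mixed H-part and the remainders** — the hypothesis `hW` of the mixed
Lemma T `MixCSH.mixCshMargin_nonneg_of_within` modulo Lemma H-mix and Lemma R⁻: for weights `< 1`, distinct data (`o ≠ v`, decoys off `x, Y, o, v`),
`g` monotone `≥ 0`, IF `0 ≤ Hpart-mix` (`hHP`, the conclusion of `MixCSH.hpart_nonneg_hub` at `S = {x} ∪ D`, `p = mixObsConst w Σ v ({x}∪Y∪D)`), the lower-level
MIXED margins are nonnegative (`hIH`) and every remainder `R'` is `≤ 0` (`hR`), THEN `0 ≤ ∫_{x↮Y} Marg[W^ω_g] dμ_w`.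
(transcription of the cell memo prim-ineq-gen-7 PROOF-Q9-MIXED-CSH.md §3.5) [cite: KozmaNitzan2024, Question 9 (§5.5 p. 36)] -/
theorem mix_within_nonneg_of_hpart (w : Sym2 V → unitInterval) (hw : ∀ e, w e < 1) (Sig : Set V) (x : V) (Y : Set V)
    (D : List V) (o v : V) (hov : o ≠ v) (hnd : D.Nodup) (hD : ∀ d ∈ D, d ≠ x ∧ d ∉ Y ∧ d ≠ o ∧ d ≠ v)
    {g : Set (Sym2 V) → ℝ} (hg : Monotone g)
    (hIH : ∀ (pre : List V) (d : V) (ds' : List V), D = pre ++ d :: ds' →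
      ∀ h : Set (Sym2 V) → ℝ, Monotone h → (∀ C, 0 ≤ h C) →
        0 ≤ mixCshMargin w Sig d (insert x Y ∪ {e | e ∈ pre}) ds' o v h)
    (hR : ∀ (S : Set V) (d : V), x ∈ S → d ∉ S → d ∉ Y → hubRem (fun e => (w e : ℝ)) x Y g Sig d (S ∪ Y) ≤ 0)
    (hHP : 0 ≤ ∫ ω in {ω : BondConfig V | ∀ y ∈ Y, ¬ (openGraph ω).Reachable x y},
        ((if (∀ z ∈ Sig, ∀ y ∈ Y, ¬ (openGraph ω).Reachable y z) then (1 : ℝ) else 0) *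
            ((∫ η in {η : BondConfig V | ∃ z ∈ Sig, ∃ t ∈ insert x D.toFinset, (openGraph η).Reachable t z}, g (openEdgeCluster η x)
                ∂(prodBernoulli fun e => if (∃ z ∈ e, ∃ y ∈ Y, (openGraph ω).Reachable y z) then (0 : unitInterval) else w e)) -
              (prodBernoulli fun e => if (∃ z ∈ e, ∃ y ∈ Y, (openGraph ω).Reachable y z) then (0 : unitInterval) else w e).real
                  {η : BondConfig V | ∃ z ∈ Sig, ∃ t ∈ insert x D.toFinset, (openGraph η).Reachable t z} *
                (∫ η, g (openEdgeCluster η x)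
                  ∂(prodBernoulli fun e => if (∃ z ∈ e, ∃ y ∈ Y, (openGraph ω).Reachable y z) then (0 : unitInterval) else w e))) -
          mixObsConst w Sig v (insert x Y ∪ {d | d ∈ D}) *
            ((∫ η in (⋃ t ∈ insert x D.toFinset, openConn v t), g (openEdgeCluster η x)
                ∂(prodBernoulli fun e => if (∃ z ∈ e, ∃ y ∈ Y, (openGraph ω).Reachable y z) then (0 : unitInterval) else w e)) -
              (prodBernoulli fun e => if (∃ z ∈ e, ∃ y ∈ Y, (openGraph ω).Reachable y z) then (0 : unitInterval) else w e).real
                  (⋃ t ∈ insert x D.toFinset, openConn v t) *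
                (∫ η, g (openEdgeCluster η x)
                  ∂(prodBernoulli fun e => if (∃ z ∈ e, ∃ y ∈ Y, (openGraph ω).Reachable y z) then (0 : unitInterval) else w e))))
        ∂(prodBernoulli w)) :
    0 ≤ ∫ ω in {ω : BondConfig V | ∀ y ∈ Y, ¬ (openGraph ω).Reachable x y},
        cshMarg (mixDecoyList w Sig o (insert x Y) D) (mixObsConst w Sig v (insert x Y ∪ {d | d ∈ D})) o v
          (fun u => if u = o then
              (if (∀ z ∈ Sig, ∀ y ∈ Y, ¬ (openGraph ω).Reachable y z) then (1 : ℝ) else 0) *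
                ((∫ η in {η : BondConfig V | ∃ z ∈ Sig, (openGraph η).Reachable x z}, g (openEdgeCluster η x)
                    ∂(prodBernoulli fun e => if (∃ z ∈ e, ∃ y ∈ Y, (openGraph ω).Reachable y z)
                      then (0 : unitInterval) else w e)) -
                  (∫ η, g (openEdgeCluster η x)
                    ∂(prodBernoulli fun e => if (∃ z ∈ e, ∃ y ∈ Y, (openGraph ω).Reachable y z)
                      then (0 : unitInterval) else w e)) *
                  (prodBernoulli fun e => if (∃ z ∈ e, ∃ y ∈ Y, (openGraph ω).Reachable y z)
                      then (0 : unitInterval) else w e).real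
                    {η : BondConfig V | ∃ z ∈ Sig, (openGraph η).Reachable x z})
            else
              (∫ η in (openConn x u : Set (BondConfig V)), g (openEdgeCluster η x)
                  ∂(prodBernoulli fun e => if (∃ z ∈ e, ∃ y ∈ Y, (openGraph ω).Reachable y z)
                    then (0 : unitInterval) else w e)) -
                (∫ η, g (openEdgeCluster η x)
                  ∂(prodBernoulli fun e => if (∃ z ∈ e, ∃ y ∈ Y, (openGraph ω).Reachable y z)
                    then (0 : unitInterval) else w e)) *
                (prodBernoulli fun e => if (∃ z ∈ e, ∃ y ∈ Y, (openGraph ω).Reachable y z)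
                    then (0 : unitInterval) else w e).real (openConn x u : Set (BondConfig V)))
        ∂(prodBernoulli w) := by
  rw [mix_within_unfold w hw Sig x Y D o v hov hnd hD g]
  have hsub := mixSubT_comb_nonneg w Sig x Y D o v hov (fun d hd => (hD d hd).2.2.1) hg hIH D [] (by simp)
  have hS0 : ({x} ∪ {e | e ∈ ([] : List V)} : Set V) = {x} := by ext u; simp
  rw [hS0] at hsub
  have hrem := remSum_nonpos w Sig x Y g hR D {x} (Set.mem_singleton x) hnd
    (fun d hd => ⟨fun h => (hD d hd).1 (Set.mem_singleton_iff.1 h), (hD d hd).2.1⟩)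
  linarith

end MixCSH

end Summit.CriticalPhenomena.PercolationContinuityZ3.Theorems

end
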